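import Mathlib.RingTheory.RootsOfUnity.Complex
import Literature.Computability.AlgebraicComplexity.BDS24PresentableBorder
import Literature.Computability.AlgebraicComplexity.Bur24UnboundedDegreeClassesField
import Literature.Computability.AlgebraicComplexity.BurgisserBooleanPartsA3Steps
import HarnessLib

/-!
# Exponential interpolation at roots of unity: `\overline{VP}_ε ⊆ VNPnb` over `ℂ`
# (Bhargav–Dwivedi–Saxena 2024, Lemma 4.1, in the setting of Bürgisser 2024, §4.2)

Topic `Computability/AlgebraicComplexity`. C. S. Bhargav, P. Dwivedi, N. Saxena, *Learning the
coefficients: a presentable version of border complexity and applications to circuit factoring*,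
STOC 2024, doi:10.1145/3618260.3649743 (held text `paper:doi-10-1145-3618260-3649743`), §1.3
(p. 9: "We will extract the coefficient of `ε^M` in `g` by carefully choosing the interpolation
points to be roots of unity, whose (multiplicative) order is 'only' exponential. Consequently, we
show that the coefficient … is a hypercube-sum of small circuits") and §4, **Lemma 4.1
(Exponential interpolation)** (p. 13: for `g = Σ_{a ∈ {0,1}^m} h(x, a)` with `m, size(h) ≤ s` and
`deg g ≤ d = exp(s)`, each coefficient of `g` is `Σ_{e ∈ {0,1}^ℓ} g̃(e_1, …, e_ℓ)` with `ℓ` and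
`size(g̃)` at most `poly(s)`, over a field extension containing the roots of unity); P. Bürgisser,
*Completeness classes in algebraic complexity theory*, arXiv:2406.06217 (2024), §4.2 (the
unbounded-degree classes `VPnb^F`, `VNPnb^F`; tree file `Bur24UnboundedDegreeClassesField`).

WHAT IS PROVED HERE (the `ε`-coefficient case of Lemma 4.1, which is the one the presentable class
`\overline{VP}_ε` needs, over any field containing primitive `2^t`-th roots of unity for all `t` —
e.g. `ℂ`): if `G(x, ε) ∈ F[x_σ, ε]` presents `f` to order `M` (`Presents M G f`, i.e.
`G = ε^M f + ε^{M+1} S`), then `f` is the coefficient of `ε^M` in `G` (`Presents.coeffEps_eq`), and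
for `N = 2^t > max(deg_ε G, M)` and a primitive `N`-th root of unity `ω` the discrete Fourier
inversion `f = N^{-1} Σ_{i<N} ω^{(N-M) i} G(x, ω^i)` (`sum_epsEval_rootOfUnity`) is a Boolean sum
`Σ_{e ∈ {0,1}^t} g(x, e)` of the polynomial
`g = N^{-1} · Π_j (1 + e_j (ω^{(N-M) 2^j} - 1)) · G(x, Π_j (1 + e_j (ω^{2^j} - 1)))`
(`boolSum_interpolant`: the selector products evaluate to `ω^{(N-M) i(e)}` and `ω^{i(e)}` at the
Boolean point `e` with binary value `i(e) = Σ_j e_j 2^j`), whose circuit size is `≤ 7 L(G) + 8` for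
`t = L(G) + 1` (`complexity_interpolant_le`; `deg_ε G ≤ 2^{L(G)}` by the fan-in-two degree bound).
Consequently (**`IsPresVPBarFamily.isVNPnbFamily_of_primitiveRoots`**, over `ℂ`
**`IsPresVPBarFamily.isVNPnbFamily`**): a p-family with p-bounded presentable border complexity is
in Bürgisser's class `VNPnb` (a p-bounded Boolean sum of p-size circuits, NO degree bound on the
summand) — `\overline{VP}_ε ∩ {p-families} ⊆ VNPnb^ℂ`. The degree of the summand `g` is exponential
(it carries `deg_ε G`), which is exactly why this does not give `\overline{VP}_ε ⊆ VNP` in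
characteristic zero (BDS 2024 §6, p. 16: "The question whether `\overline{VNP}_ε` is contained in
`VNP`, remains open over `ℚ`; due to the possibility of doubly-exponentially large integers
appearing"); over finite fields BDS continue with Boolean simulation (their Lemma 4.2) and Valiant's
criterion. The neutral proposition `VNPnbPFamSubsetVNP F` ("`VNPnb ∩ {p-families} ⊆ VNP` over `F`")
records the remaining step: it implies `PresVPBarSubsetVNP` over `ℂ`
(`presVPBarSubsetVNP_of_vnpnbPFamSubsetVNP`), and conversely every `VNPnb` family is trivially in
`\overline{VNP}_ε` (`IsVNPnbFamily.isPresVNPBarFamily`, order `M = 0`), so that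
`PresVNPBarSubsetVNP F → VNPnbPFamSubsetVNP F` over every field.

Honest framing: an elementary identity (finite Fourier inversion on the group of `N`-th roots of
unity) and its bookkeeping in the tree's circuit-size currency; the source states Lemma 4.1 over
finite fields with a field extension supplying the roots of unity and defers its proof to the full
version — the present file proves the characteristic-zero instance that needs no extension. No
instances, no notation, no named facts.

## Main results

* `coeffEps`, `epsEval`, `Presents.coeffEps_eq`, `Presents.le_degreeOf_none` — the coefficient of
  `ε^M` of a presentation is the presented polynomial (`degreeOf_none_le_two_pow_complexity`: the
  `ε`-degree is at most `2^{size}`).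
* `sum_pow_mul_eval_pow_eq` (Fourier inversion for a univariate polynomial of degree `< N` at a
  primitive `N`-th root of unity), `sum_epsEval_rootOfUnity`.
* `binVal`, `selPow`, `interpolant`, `boolSum_interpolant`, `complexity_interpolant_le` (private
  helpers: re-indexing the Boolean cube by binary value, evaluation of the selector products).
* `IsPresVPBarFamily.isVNPnbFamily_of_primitiveRoots`, `IsPresVPBarFamily.isVNPnbFamily` (`ℂ`).
* `VNPnbPFamSubsetVNP`, `IsVNPnbFamily.isPresVNPBarFamily`,
  `vnpnbPFamSubsetVNP_of_presVNPBarSubsetVNP`, `presVPBarSubsetVNP_of_vnpnbPFamSubsetVNP` (`ℂ`)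
  (private helper `map_boolSum`: change of scalars commutes with the Boolean sum).

## References

* [BhargavDwivediSaxena2024] C. S. Bhargav, P. Dwivedi, N. Saxena, STOC 2024,
  doi:10.1145/3618260.3649743, §1.3 (pp. 9–10), Lemma 4.1 (p. 13), §6 (p. 16).
* [Burgisser2024Completeness] P. Bürgisser, arXiv:2406.06217 (2024), §4.2 (p0016–p0017).
* [arXiv:2510.13049] P. Dutta, V. Lysikov, *Recent advances in debordering methods* (2025), §3.4.
-/

noncomputable section

open MvPolynomial Finset

universe u v

namespace Literature.Computability.AlgebraicComplexity

/-! ### The coefficient of `ε^M` of a presentation -/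

section EpsCoeff

variable {F : Type u} [Field F] {σ : Type v}

/-- The coefficient of `ε^i` in `G ∈ F[x_σ, ε]` (variable type `Option σ`, `none` = `ε`), a
polynomial in `F[x_σ]`. [cite: BhargavDwivediSaxena2024, §1.3 (p. 9: "extract the coefficient of ε^M in g")] -/
def coeffEps (i : ℕ) (G : MvPolynomial (Option σ) F) : MvPolynomial σ F :=
  (optionEquivLeft F σ G).coeff i

/-- The evaluation `ε ↦ c` of `G ∈ F[x_σ, ε]` at a scalar `c ∈ F`: `G(x, c) ∈ F[x_σ]`.
[cite: BhargavDwivediSaxena2024, §1.3 (p. 9: interpolation points)] -/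
def epsEval (c : F) (G : MvPolynomial (Option σ) F) : MvPolynomial σ F :=
  aeval (fun o : Option σ => o.elim (C c) X) G

/-- `optionEquivLeft` turns the substitution `ε ↦ z` into univariate evaluation at `z`. [folklore] -/
private theorem eval_optionEquivLeft_eq_aeval_elim (G : MvPolynomial (Option σ) F) (z : MvPolynomial σ F) :
    Polynomial.eval z (optionEquivLeft F σ G) = aeval (fun o : Option σ => o.elim z X) G := by
  have key : ((Polynomial.aeval z : Polynomial (MvPolynomial σ F) →ₐ[MvPolynomial σ F]
      MvPolynomial σ F).restrictScalars F).comp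
        (optionEquivLeft F σ : MvPolynomial (Option σ) F →ₐ[F] Polynomial (MvPolynomial σ F)) =
      aeval (fun o : Option σ => o.elim z X) := by
    refine MvPolynomial.algHom_ext fun o => ?_
    rcases o with _ | b
    · simp [optionEquivLeft_X_none]
    · simp [optionEquivLeft_X_some]
  have := AlgHom.congr_fun key G
  simpa [Polynomial.coe_aeval_eq_eval] using this

/-- `G(x, c)` is the evaluation of `optionEquivLeft G` at the constant `C c`. [folklore] -/
private theorem eval_optionEquivLeft_eq_epsEval (G : MvPolynomial (Option σ) F) (c : F) :
    Polynomial.eval (C c) (optionEquivLeft F σ G) = epsEval c G :=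
  eval_optionEquivLeft_eq_aeval_elim G (C c)

/-- The `ε`-degree of a polynomial of circuit size `s` is at most `2^s` (fan-in-two degree bound
`totalDegree_eval_le_two_pow_size`). [cite: BhargavDwivediSaxena2024, §1.3 (p. 9: "order is 'only' exponential")] -/
theorem degreeOf_none_le_two_pow_complexity (G : MvPolynomial (Option σ) F) :
    G.degreeOf none ≤ 2 ^ complexity G := by
  obtain ⟨P, h2, hP, hs⟩ := ArithCircuit.exists_computes_size_eq_complexity G
  have hPe : P.eval = G := hP
  calc G.degreeOf none ≤ G.totalDegree := degreeOf_le_totalDegree G none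
    _ = P.eval.totalDegree := by rw [hPe]
    _ ≤ 2 ^ P.size := totalDegree_eval_le_two_pow_size h2
    _ = 2 ^ complexity G := by rw [hs]

/-- Reading `G ∈ F[x_σ, ε]` in `F((ε))[x_σ]` (`ε ↦` the Laurent variable) is the finite sum
`Σ_{i<n} ε^i · G_i(x)` over its `ε`-coefficients, for any `n` exceeding the `ε`-degree. [folklore] -/
private theorem aeval_epsSubst_map_eq_sum (G : MvPolynomial (Option σ) F) {n : ℕ}
    (hn : G.degreeOf none < n) :
    aeval (epsSubst F σ) (MvPolynomial.map (algebraMap F (LaurentSeries F)) G) =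
      ∑ i ∈ range n, C (HahnSeries.single (i : ℤ) (1 : F)) *
        MvPolynomial.map (algebraMap F (LaurentSeries F)) (coeffEps i G) := by
  set ι := algebraMap F (LaurentSeries F) with hι
  -- the ring hom `P ↦ P(map ι)(C ε)` on `F[x_σ][ε]`
  set Φ : Polynomial (MvPolynomial σ F) →+* MvPolynomial σ (LaurentSeries F) :=
    Polynomial.eval₂RingHom (MvPolynomial.map ι : MvPolynomial σ F →+* MvPolynomial σ (LaurentSeries F))
      (C (HahnSeries.single (1 : ℤ) (1 : F))) with hΦ
  have key : Φ.comp ((optionEquivLeft F σ : MvPolynomial (Option σ) F ≃ₐ[F]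
      Polynomial (MvPolynomial σ F)) : MvPolynomial (Option σ) F →+* Polynomial (MvPolynomial σ F)) =
      ((aeval (epsSubst F σ) : MvPolynomial (Option σ) (LaurentSeries F) →ₐ[LaurentSeries F]
        MvPolynomial σ (LaurentSeries F)) : MvPolynomial (Option σ) (LaurentSeries F) →+*
          MvPolynomial σ (LaurentSeries F)).comp (MvPolynomial.map ι) := by
    refine MvPolynomial.ringHom_ext (fun r => ?_) (fun o => ?_)
    · simp [hΦ, optionEquivLeft_C]
    · rcases o with _ | b
      · simp [hΦ, optionEquivLeft_X_none, epsSubst]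
      · simp [hΦ, optionEquivLeft_X_some, epsSubst]
  have hG := RingHom.congr_fun key G
  simp only [RingHom.coe_comp, Function.comp_apply, RingHom.coe_coe] at hG
  have hdeg : (optionEquivLeft F σ G).natDegree < n := by rwa [natDegree_optionEquivLeft]
  rw [← hG, hΦ, Polynomial.coe_eval₂RingHom, Polynomial.eval₂_eq_sum_range' _ hdeg]
  refine sum_congr rfl fun i _ => ?_
  rw [mul_comm, ← map_pow, HahnSeries.single_pow]
  simp [coeffEps]

/-- **The coefficient of `ε^M` of a presentation of `f` to order `M` is `f`** (`G = ε^M f +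
ε^{M+1} S` read off coefficientwise). [cite: BhargavDwivediSaxena2024, Def. 4.3 and §1.3 (p. 9)] -/
theorem Presents.coeffEps_eq {M : ℕ} {G : MvPolynomial (Option σ) F} {f : MvPolynomial σ F}
    (h : Presents M G f) : coeffEps M G = f := by
  classical
  set n := max (G.degreeOf none) M + 1 with hn
  have hGn : G.degreeOf none < n := by omega
  have hMn : M < n := by omega
  ext e
  have h0 := h e 0 zero_lt_one
  rw [aeval_epsSubst_map_eq_sum G hGn, coeff_sub, coeff_C_mul, coeff_sum, coeff_map,
    algebraMap_laurentSeries_apply, HahnSeries.coeff_sub, mul_sum, HahnSeries.coeff_sum] at h0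
  simp only [coeff_C_mul, coeff_map, algebraMap_laurentSeries_apply, HahnSeries.C_apply,
    HahnSeries.single_mul_single, one_mul, HahnSeries.coeff_single] at h0
  have hiff : ∀ i : ℕ, ((0 : ℤ) = -(M : ℤ) + ((i : ℤ) + 0)) ↔ i = M := fun i => by omega
  simp only [hiff, sum_ite_eq', mem_range, hMn, if_true, sub_eq_zero] at h0
  exact h0

/-- A presentation of a NON-ZERO polynomial has order at most its `ε`-degree. [cite: BhargavDwivediSaxena2024, Def. 4.3] -/
theorem Presents.le_degreeOf_none {M : ℕ} {G : MvPolynomial (Option σ) F} {f : MvPolynomial σ F}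
    (h : Presents M G f) (hf : f ≠ 0) : M ≤ G.degreeOf none := by
  by_contra hlt
  rw [not_le] at hlt
  apply hf
  rw [← h.coeffEps_eq, coeffEps, Polynomial.coeff_eq_zero_of_natDegree_lt]
  rwa [natDegree_optionEquivLeft]

end EpsCoeff

/-! ### Fourier inversion on the `N`-th roots of unity -/

section Fourier

/-- **Finite Fourier inversion**: for a primitive `N`-th root of unity `ω` in a domain, a
univariate polynomial `P` of degree `< N` and `M < N`,
`Σ_{i<N} ω^{(N-M) i} P(ω^i) = N · P_M`. [cite: BhargavDwivediSaxena2024, Lemma 4.1 (p. 13, exponential interpolation at roots of unity)] -/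
theorem sum_pow_mul_eval_pow_eq {R : Type*} [CommRing R] [IsDomain R] {ω : R} {N : ℕ}
    (hω : IsPrimitiveRoot ω N) (P : Polynomial R) (hP : P.natDegree < N) {M : ℕ} (hM : M < N) :
    ∑ i ∈ range N, ω ^ ((N - M) * i) * P.eval (ω ^ i) = (N : R) * P.coeff M := by
  have hinner : ∀ j ∈ range N, ∑ i ∈ range N, ω ^ ((N - M) * i) * (ω ^ i) ^ j =
      if j = M then (N : R) else 0 := by
    intro j hj
    rw [mem_range] at hj
    have hre : ∀ i : ℕ, ω ^ ((N - M) * i) * (ω ^ i) ^ j = (ω ^ (N - M + j)) ^ i := fun i => by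
      rw [← pow_mul, ← pow_mul, ← pow_add]
      congr 1
      ring
    simp_rw [hre]
    split_ifs with hjM
    · have h1 : ω ^ (N - M + j) = 1 := by
        rw [hjM, Nat.sub_add_cancel hM.le]
        exact hω.pow_eq_one
      rw [h1]
      simp
    · have hne : ω ^ (N - M + j) ≠ 1 := by
        rw [Ne, hω.pow_eq_one_iff_dvd]
        intro hdvd
        have := Nat.eq_of_dvd_of_lt_two_mul (by omega) hdvd (by omega)
        omega
      have hpow : (ω ^ (N - M + j)) ^ N = 1 := by
        rw [← pow_mul, mul_comm, pow_mul, hω.pow_eq_one, one_pow]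
      have key := geom_sum_mul (ω ^ (N - M + j)) N
      rw [hpow, sub_self] at key
      exact (mul_eq_zero.mp key).resolve_right (sub_ne_zero.mpr hne)
  calc ∑ i ∈ range N, ω ^ ((N - M) * i) * P.eval (ω ^ i)
      = ∑ i ∈ range N, ∑ j ∈ range N, P.coeff j * (ω ^ ((N - M) * i) * (ω ^ i) ^ j) := by
        refine sum_congr rfl fun i _ => ?_
        rw [Polynomial.eval_eq_sum_range' hP, mul_sum]
        refine sum_congr rfl fun j _ => ?_
        ring
    _ = ∑ j ∈ range N, P.coeff j * ∑ i ∈ range N, ω ^ ((N - M) * i) * (ω ^ i) ^ j := by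
        rw [sum_comm]
        refine sum_congr rfl fun j _ => ?_
        rw [mul_sum]
    _ = ∑ j ∈ range N, P.coeff j * (if j = M then (N : R) else 0) :=
        sum_congr rfl fun j hj => by rw [hinner j hj]
    _ = (N : R) * P.coeff M := by
        simp_rw [mul_ite, mul_zero]
        rw [sum_ite_eq' (range N) M, if_pos (mem_range.mpr hM), mul_comm]

variable {F : Type u} [Field F] {σ : Type v}

/-- **Exponential interpolation, `ε`-coefficient form**: `Σ_{i<N} ω^{(N-M) i} · G(x, ω^i) =
N · G_M(x)` for `N > deg_ε G`, `N > M`, `ω` a primitive `N`-th root of unity.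
[cite: BhargavDwivediSaxena2024, Lemma 4.1 (p. 13)] -/
theorem sum_epsEval_rootOfUnity {ω : F} {N M : ℕ} (hω : IsPrimitiveRoot ω N)
    (G : MvPolynomial (Option σ) F) (hG : G.degreeOf none < N) (hM : M < N) :
    ∑ i ∈ range N, C (ω ^ ((N - M) * i)) * epsEval (ω ^ i) G = C (N : F) * coeffEps M G := by
  have hω' : IsPrimitiveRoot (C ω : MvPolynomial σ F) N :=
    hω.map_of_injective (f := (C : F →+* MvPolynomial σ F)) (C_injective σ F)
  have hdeg : (optionEquivLeft F σ G).natDegree < N := by rwa [natDegree_optionEquivLeft]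
  have key := sum_pow_mul_eval_pow_eq hω' (optionEquivLeft F σ G) hdeg hM
  simp_rw [← map_pow, eval_optionEquivLeft_eq_epsEval] at key
  rw [map_natCast]
  exact key

end Fourier

/-! ### The Boolean-sum form of the interpolation formula -/

section BoolCube

/-- The binary value `Σ_j e_j 2^j` of a Boolean vector `e ∈ {0,1}^t`. [folklore] -/
def binVal {t : ℕ} (e : Fin t → Bool) : ℕ := ∑ j : Fin t, if e j then 2 ^ (j : ℕ) else 0

/-- Values in `Fin 2` of the `Bool ≃ Fin 2` used below. [folklore] -/
private theorem val_finTwoEquiv_symm (b : Bool) : ((finTwoEquiv.symm b : Fin 2) : ℕ) = if b then 1 else 0 := by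
  cases b <;> rfl

/-- **Re-indexing a Boolean-cube sum by binary value**: `Σ_{e ∈ {0,1}^t} Φ(Σ_j e_j 2^j) =
Σ_{i < 2^t} Φ(i)`. [folklore] -/
private theorem sum_boolCube_eq_sum_range {A : Type*} [AddCommMonoid A] (t : ℕ) (Φ : ℕ → A) :
    ∑ e : Fin t → Bool, Φ (binVal e) = ∑ i ∈ range (2 ^ t), Φ i := by
  let E : (Fin t → Bool) ≃ Fin (2 ^ t) :=
    (Equiv.arrowCongr (Equiv.refl (Fin t)) finTwoEquiv.symm).trans finFunctionFinEquiv
  have hE : ∀ e : Fin t → Bool, ((E e : Fin (2 ^ t)) : ℕ) = binVal e := by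
    intro e
    show ((finFunctionFinEquiv (finTwoEquiv.symm ∘ e ∘ (Equiv.refl (Fin t)).symm) : Fin (2 ^ t)) : ℕ)
      = binVal e
    rw [finFunctionFinEquiv_apply, binVal]
    refine sum_congr rfl fun j _ => ?_
    simp only [Function.comp_apply, Equiv.refl_symm, Equiv.refl_apply, val_finTwoEquiv_symm]
    split_ifs <;> simp
  rw [← Fin.sum_univ_eq_sum_range]
  exact Fintype.sum_equiv E _ _ fun e => by rw [hE]

variable {F : Type u} [Field F] {σ : Type v}

/-- The **selector product** `Π_{j<t} (1 + y_j · (c^{2^j} - 1)) ∈ F[x_σ, y_1 … y_t]`: at a Boolean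
point `e` it evaluates to `c^{Σ_j e_j 2^j}`. [cite: BhargavDwivediSaxena2024, §1.3 (p. 10: "well structured" hypercube sum)] -/
def selPow (c : F) (t : ℕ) : MvPolynomial (σ ⊕ Fin t) F :=
  ∏ j : Fin t, (1 + X (Sum.inr j) * C (c ^ 2 ^ (j : ℕ) - 1))

/-- `Π_j (1 + e_j (c^{2^j} - 1)) = c^{binVal e}` at a Boolean point. [folklore] -/
private theorem aeval_boolPoint_selPow (c : F) {t : ℕ} (e : Fin t → Bool) :
    aeval (Sum.elim X fun j => if e j then (1 : MvPolynomial σ F) else 0) (selPow (σ := σ) c t) =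
      C (c ^ binVal e) := by
  unfold selPow binVal
  rw [map_prod, ← prod_pow_eq_pow_sum, map_prod]
  refine prod_congr rfl fun j _ => ?_
  by_cases h : e j
  · simp [h]
  · simp [h]

/-- Circuit size of the selector product: `≤ 3 t`. [folklore] -/
private theorem complexity_selPow_le (c : F) (t : ℕ) : complexity (selPow (σ := σ) c t) ≤ 3 * t := by
  unfold selPow
  refine (complexity_finset_prod_le _ _).trans ?_
  have h : ∀ j ∈ (univ : Finset (Fin t)),
      complexity (1 + X (Sum.inr j) * C (c ^ 2 ^ (j : ℕ) - 1) : MvPolynomial (σ ⊕ Fin t) F) ≤ 2 := by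
    intro j _
    calc complexity (1 + X (Sum.inr j) * C (c ^ 2 ^ (j : ℕ) - 1) : MvPolynomial (σ ⊕ Fin t) F)
        ≤ complexity (1 : MvPolynomial (σ ⊕ Fin t) F) +
            complexity (X (Sum.inr j) * C (c ^ 2 ^ (j : ℕ) - 1) : MvPolynomial (σ ⊕ Fin t) F) + 1 :=
          complexity_add_le_holds _ _
      _ ≤ 0 + (0 + 0 + 1) + 1 := by
          gcongr
          · rw [← C_1, complexity_C_holds]
          · exact (complexity_mul_le_holds _ _).trans
              (by rw [complexity_X_holds, complexity_C_holds])
      _ = 2 := by norm_num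
  calc ∑ j : Fin t, complexity (1 + X (Sum.inr j) * C (c ^ 2 ^ (j : ℕ) - 1) :
          MvPolynomial (σ ⊕ Fin t) F) + (univ : Finset (Fin t)).card
      ≤ ∑ _j : Fin t, 2 + (univ : Finset (Fin t)).card :=
        Nat.add_le_add_right (sum_le_sum h) _
    _ = 3 * t := by
        simp only [sum_const, card_univ, Fintype.card_fin, smul_eq_mul]
        ring

/-- Substituting the selector product for `ε` and then a Boolean point `e` for `y` evaluates
`G` at `ε = c^{binVal e}`. [folklore] -/
private theorem aeval_boolPoint_aeval_selPow (c : F) {t : ℕ} (e : Fin t → Bool)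
    (G : MvPolynomial (Option σ) F) :
    aeval (Sum.elim X fun j => if e j then (1 : MvPolynomial σ F) else 0)
      (aeval (fun o : Option σ => o.elim (selPow (σ := σ) c t) (fun x => X (Sum.inl x))) G) =
    epsEval (c ^ binVal e) G := by
  unfold epsEval
  rw [comp_aeval_apply]
  exact congrArg (fun θ : Option σ → MvPolynomial σ F => aeval θ G) (funext fun o => by
    rcases o with _ | x
    · exact aeval_boolPoint_selPow c e
    · simp)

/-- The **interpolant** `g(x, e) = N^{-1} · Π_j (1 + e_j (ω^{(N-M) 2^j} - 1)) ·
G(x, Π_j (1 + e_j (ω^{2^j} - 1)))`, a polynomial in `F[x_σ, y_1 … y_t]` whose Boolean sum over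
`e ∈ {0,1}^t` is `N^{-1} Σ_{i < 2^t} ω^{(N-M) i} G(x, ω^i)`.
[cite: BhargavDwivediSaxena2024, Lemma 4.1 (p. 13: the polynomial g̃ with Σ_e g̃(e) = coefficient)] -/
def interpolant (ω : F) (N M t : ℕ) (G : MvPolynomial (Option σ) F) : MvPolynomial (σ ⊕ Fin t) F :=
  C ((N : F)⁻¹) * (selPow (ω ^ (N - M)) t *
    aeval (fun o : Option σ => o.elim (selPow ω t) (fun x => X (Sum.inl x))) G)

/-- **The Boolean sum of the interpolant is the presented polynomial**: for `N = 2^t`, `ω` a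
primitive `N`-th root of unity, `deg_ε G < N`, `M < N` and `G` presenting `f` to order `M`,
`Σ_{e ∈ {0,1}^t} g(x, e) = f`. [cite: BhargavDwivediSaxena2024, Lemma 4.1 (p. 13)] -/
theorem boolSum_interpolant {ω : F} {t M : ℕ} (hω : IsPrimitiveRoot ω (2 ^ t))
    {G : MvPolynomial (Option σ) F} {f : MvPolynomial σ F} (hP : Presents M G f)
    (hG : G.degreeOf none < 2 ^ t) (hM : M < 2 ^ t) :
    boolSum (interpolant ω (2 ^ t) M t G) = f := by
  classical
  haveI : NeZero (2 ^ t) := ⟨pow_ne_zero t two_ne_zero⟩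
  have hN : ((2 ^ t : ℕ) : F) ≠ 0 := (hω.neZero').out
  have hpt : ∀ e : Fin t → Bool,
      aeval (Sum.elim X fun j => if e j then (1 : MvPolynomial σ F) else 0)
        (interpolant ω (2 ^ t) M t G) =
      C (((2 ^ t : ℕ) : F)⁻¹) * (C ((ω ^ (2 ^ t - M)) ^ binVal e) * epsEval (ω ^ binVal e) G) := by
    intro e
    unfold interpolant
    rw [map_mul, map_mul, aeval_C, algebraMap_eq, aeval_boolPoint_selPow,
      aeval_boolPoint_aeval_selPow]
  unfold boolSum
  simp_rw [hpt]
  rw [sum_boolCube_eq_sum_range t (fun i => C (((2 ^ t : ℕ) : F)⁻¹) *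
    (C ((ω ^ (2 ^ t - M)) ^ i) * epsEval (ω ^ i) G)), ← mul_sum]
  simp_rw [← pow_mul]
  rw [sum_epsEval_rootOfUnity hω G hG hM, ← mul_assoc, ← map_mul, inv_mul_cancel₀ hN, C_1,
    one_mul, hP.coeffEps_eq]

/-- **Circuit size of the interpolant**: `L(g) ≤ L(G) + 6 t + 2`. [cite: BhargavDwivediSaxena2024, Lemma 4.1 (p. 13: size(g̃) ≤ poly(s))] -/
theorem complexity_interpolant_le [Fintype σ] (ω : F) (N M t : ℕ) (G : MvPolynomial (Option σ) F) :
    complexity (interpolant ω N M t G) ≤ complexity G + 6 * t + 2 := by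
  unfold interpolant
  have hA : complexity (aeval (fun o : Option σ => o.elim (selPow ω t) (fun x => X (Sum.inl x))) G :
      MvPolynomial (σ ⊕ Fin t) F) ≤ complexity G + 3 * t := by
    refine (complexity_aeval_le _ _).trans ?_
    rw [Fintype.sum_option]
    have hs : ∑ x : σ, complexity ((fun o : Option σ => o.elim (selPow (σ := σ) ω t)
        (fun x => X (Sum.inl x))) (some x) : MvPolynomial (σ ⊕ Fin t) F) = 0 :=
      sum_eq_zero fun x _ => complexity_X_holds _
    rw [hs, add_zero]
    exact Nat.add_le_add_left (complexity_selPow_le ω t) _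
  calc complexity (C ((N : F)⁻¹) * (selPow (ω ^ (N - M)) t *
          aeval (fun o : Option σ => o.elim (selPow ω t) (fun x => X (Sum.inl x))) G))
      ≤ complexity (C ((N : F)⁻¹) : MvPolynomial (σ ⊕ Fin t) F) +
          complexity (selPow (ω ^ (N - M)) t *
            aeval (fun o : Option σ => o.elim (selPow ω t) (fun x => X (Sum.inl x))) G) + 1 :=
        complexity_mul_le_holds _ _
    _ ≤ 0 + (3 * t + (complexity G + 3 * t) + 1) + 1 := by
        gcongr
        · exact (complexity_C_holds _).le
        · exact (complexity_mul_le_holds _ _).trans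
            (add_le_add (add_le_add (complexity_selPow_le _ t) hA) le_rfl)
    _ = complexity G + 6 * t + 2 := by ring

end BoolCube

/-! ### `\overline{VP}_ε ⊆ VNPnb` -/

section Families

variable {F : Type u} [Field F] {ς : ℕ → Type v} [∀ n, Fintype (ς n)]

/-- **`\overline{VP}_ε ∩ {p-families} ⊆ VNPnb`** over a field with primitive `2^t`-th roots of unity
for every `t`: a p-family with p-bounded presentable border complexity is a p-bounded Boolean sum
of p-size circuits (of unbounded degree). Witness: for `f_n ≠ 0` the interpolant of a size-optimal
presentation `G_n` with `t_n = L(G_n) + 1` (so `2^{t_n} > deg_ε G_n ≥ M_n`), for `f_n = 0` the zero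
polynomial. [cite: BhargavDwivediSaxena2024, Lemma 4.1 (p. 13) with Def. 4.3] -/
theorem IsPresVPBarFamily.isVNPnbFamily_of_primitiveRoots {f : ∀ n, MvPolynomial (ς n) F}
    (ω : ℕ → F) (hω : ∀ t, IsPrimitiveRoot (ω t) (2 ^ t))
    (hpf : IsPFamily f) (hf : IsPresVPBarFamily f) : IsVNPnbFamily f := by
  classical
  choose M G hc hP using fun n => exists_presents_complexity_le (f n)
  let t : ℕ → ℕ := fun n => complexity (G n) + 1
  have ht : IsPBounded t :=
    (IsPBounded.add_holds hf (IsPBounded.const 1)).mono fun n => Nat.add_le_add_right (hc n) 1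
  refine ⟨t, fun n => if f n = 0 then 0 else interpolant (ω (t n)) (2 ^ t n) (M n) (t n) (G n),
    ?_, fun n => ?_⟩
  · rw [isVPnbFamily_iff_isPComputable]
    refine ⟨(IsPBounded.add_holds hpf.1 ht).mono fun n => by simp [Fintype.card_sum], ?_⟩
    refine (IsPBounded.add_holds (IsPBounded.add_holds hf
      (IsPBounded.mul_holds (IsPBounded.const 6) ht)) (IsPBounded.const 2)).mono fun n => ?_
    dsimp only
    split_ifs with h0
    · rw [← C_0, complexity_C_holds]
      exact Nat.zero_le _
    · exact (complexity_interpolant_le _ _ _ _ _).trans (by have := hc n; omega)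
  · dsimp only
    split_ifs with h0
    · rw [h0]
      simp [boolSum]
    · have hdeg : (G n).degreeOf none < 2 ^ t n :=
        (degreeOf_none_le_two_pow_complexity (G n)).trans_lt
          (Nat.pow_lt_pow_right (by norm_num) (Nat.lt_succ_self _))
      exact (boolSum_interpolant (hω (t n)) (hP n) hdeg
        (((hP n).le_degreeOf_none h0).trans_lt hdeg)).symm

/-- **`\overline{VP}_ε ∩ {p-families} ⊆ VNPnb^ℂ`** (primitive roots of unity of every order exist in
`ℂ`, `Complex.isPrimitiveRoot_exp`). [cite: BhargavDwivediSaxena2024, Lemma 4.1 (p. 13) with Def. 4.3] -/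
theorem IsPresVPBarFamily.isVNPnbFamily {f : ∀ n, MvPolynomial (ς n) ℂ}
    (hpf : IsPFamily f) (hf : IsPresVPBarFamily f) : IsVNPnbFamily f :=
  hf.isVNPnbFamily_of_primitiveRoots
    (fun t => Complex.exp (2 * Real.pi * Complex.I / ((2 ^ t : ℕ) : ℂ)))
    (fun t => Complex.isPrimitiveRoot_exp (2 ^ t) (pow_ne_zero t two_ne_zero)) hpf

/-- The STATEMENT "`VNPnb ∩ {p-families} ⊆ VNP` over `F`" (p-families on the variable sets
`Fin (v n)`): a p-bounded Boolean sum of p-size circuits of UNBOUNDED degree whose value has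
p-bounded degree is p-definable. Over a finite field a consequence of BDS 2024 Thm. 1.3
(`vnpnbPFamSubsetVNP_of_presVNPBarSubsetVNP` with `BDS2024_thm_1_3`); over `ℚ`, `ℂ` OPEN — the
unbounded-degree summand may produce "doubly-exponentially large integers" (BDS 2024 §6, p. 16),
cf. Bürgisser 2024 Thm. 4.10 (under GRH, `VP = VNP ⟺ VPnb = VNPnb` in characteristic zero).
Recorded as a proposition, asserted for no field. [cite: BhargavDwivediSaxena2024, §6 (p. 16)] -/
def VNPnbPFamSubsetVNP (F : Type u) [Field F] : Prop :=
  ∀ (v : ℕ → ℕ) (f : ∀ n, MvPolynomial (Fin (v n)) F),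
    IsPFamily f → IsVNPnbFamily f → IsVNPFamily f

/-- Change of scalars commutes with Valiant's Boolean sum. [folklore] -/
private theorem map_boolSum {R S : Type*} [CommSemiring R] [CommSemiring S] (φ : R →+* S) {τ : Type*}
    {m : ℕ} (g : MvPolynomial (τ ⊕ Fin m) R) :
    MvPolynomial.map φ (boolSum g) = boolSum (MvPolynomial.map φ g) := by
  unfold boolSum
  rw [map_sum]
  refine sum_congr rfl fun e _ => ?_
  show MvPolynomial.map φ (bind₁ _ g) = bind₁ _ (MvPolynomial.map φ g)
  rw [map_bind₁]
  exact congrArg (fun θ : τ ⊕ Fin m → MvPolynomial τ S => bind₁ θ (MvPolynomial.map φ g))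
    (funext fun i => by
      rcases i with x | j
      · simp
      · by_cases h : e j <;> simp [h])

/-- `VNPnb ⊆ \overline{VNP}_ε` (present the Boolean sum by itself, order `M = 0`, no `ε`).
[cite: BhargavDwivediSaxena2024, §1.2 (p. 5: VNP ⊆ \overline{VNP}_ε, same argument)] -/
theorem IsVNPnbFamily.isPresVNPBarFamily {f : ∀ n, MvPolynomial (ς n) F} (hf : IsVNPnbFamily f) :
    IsPresVNPBarFamily f := by
  obtain ⟨u, g, hg, hfg⟩ := hf
  obtain ⟨-, hL⟩ := (isVPnbFamily_iff_isPComputable g).1 hg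
  refine ⟨u, fun _ => 0, fun n => rename some (g n), hg.1.mono fun n => ?_,
    hL.mono fun n => complexity_rename_le_holds' _ (g n), fun n => ?_⟩
  · have : u n ≤ Fintype.card (ς n) + u n := Nat.le_add_left _ _
    simpa only [Fintype.card_sum, Fintype.card_fin] using this
  · -- `PresentsSum 0 (rename some g) f`: the Boolean sum commutes with the (ε-free) embedding
    unfold PresentsSum
    have hθ : (epsSubst F (ς n ⊕ Fin (u n))) ∘ some = X := funext fun _ => rfl
    have hbs : boolSum (aeval (epsSubst F (ς n ⊕ Fin (u n)))
        (MvPolynomial.map (algebraMap F (LaurentSeries F)) (rename some (g n)))) =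
        MvPolynomial.map (algebraMap F (LaurentSeries F)) (f n) := by
      rw [map_rename, aeval_rename, hθ, aeval_X_left_apply, hfg n, map_boolSum]
    rw [Nat.cast_zero, neg_zero, HahnSeries.single_zero_one, map_one, one_mul, hbs, sub_self]
    exact PolyOrdGE.zero 1

/-- `\overline{VNP}_ε ⊆ VNP` gives `VNPnb ∩ {p-families} ⊆ VNP` (over every field).
[cite: BhargavDwivediSaxena2024, Thm. 1.3 and §6 (p. 16)] -/
theorem vnpnbPFamSubsetVNP_of_presVNPBarSubsetVNP {F : Type u} [Field F]
    (h : PresVNPBarSubsetVNP F) : VNPnbPFamSubsetVNP F :=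
  fun v f hpf hf => h v f hpf hf.isPresVNPBarFamily

/-- **Over `ℂ`, `VNPnb ∩ {p-families} ⊆ VNP` gives `\overline{VP}_ε ⊆ VNP`** (exponential
interpolation supplies the unbounded-degree Boolean sum). [cite: BhargavDwivediSaxena2024, Lemma 4.1 (p. 13) and §6 (p. 16)] -/
theorem presVPBarSubsetVNP_of_vnpnbPFamSubsetVNP (h : VNPnbPFamSubsetVNP ℂ) :
    PresVPBarSubsetVNP ℂ :=
  fun v f hpf hf => h v f hpf (hf.isVNPnbFamily hpf)

end Families

end Literature.Computability.AlgebraicComplexity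

end
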